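import Mathlib
import HarnessLib
import Summits.Ventures.LatticeQCDFlow.Exactness.NCMCGeneralSpaceReplicaSumCLT
import Summits.Ventures.LatticeQCDFlow.Exactness.NCMCGeneralSpaceDoeblinPowerCLT
import Summits.Ventures.LatticeQCDFlow.Exactness.NCMCGeneralSpaceGammaMethodStudentizedCLT

/-!
# Pooling replicas of UNEQUAL lengths: `R` independent chains of lengths `N_r(n)` with `N_r(n)/n → ρ_r > 0`, from ANY starts — `√N (x̄_N − πf) ⇒ N(0, σ²_f)` at the TOTAL sample size `N = Σ_r N_r`

HONEST FRAMING: exact (Metropolis-corrected) sampling algorithms for lattice gauge theory;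
figures of merit are autocorrelation/cost numbers at stated couplings and volumes; no
continuum-physics claim.

Venture `LatticeQCDFlow` (cell pub-lqcd), topic `Exactness`; FANOUT row 13 (`eng-snf`, GEN-24).  NEW
WORK of the cell against Mathlib (Slutsky `TendstoInDistribution.continuous_comp_prodMk_of_
tendstoInMeasure_const`, `gaussianReal_map_const_mul`) and the tree's GEN-23 R1
`tendstoInDistribution_pi_sum` (independent Gaussian limits add), GEN-19
`tendstoInDistribution_timeAverage_of_nHit` (the CLT of ONE chain from ANY initial law) and GEN-20
`cltVariance_eq_autocov`; not a published result (Wolff 2004 §3's replica pooling NAMED ONLY); no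
definition is introduced.

WHY (row 13).  GEN-23 R2 (`NCMCGeneralSpaceReplicaPooledCLT`) typed the pooled CLT for `R` replicas
of EQUAL length `n`, and listed "unequal replica lengths" as NOT CLAIMED.  In practice the engine's
batched streams (and UWerr's replica input) have different lengths `N_1, …, N_R`, pooled at the TOTAL
sample size `N = Σ_r N_r`: `x̄_N = (Σ_r Σ_{t<N_r} f(x^r_t))/N`.  This file proves the CLT in that
generality along ANY length schedules `N_r(n)` with `N_r(n)/n → ρ_r ∈ (0, ∞)` (so the replicas grow
proportionally, in any ratios): `√N(n) (x̄_{N(n)} − πf) ⇒ N(0, σ²_f)` from EVERY family of initial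
laws — the pooled run of total length `N` carries exactly the error bar `√(σ²_f/N)` of one
equilibrium run of length `N`, whatever the split and the starts.

## Content
* `TendstoInDistribution.comp_tendsto` (§1) — convergence in distribution along `atTop` passes to
  any subsequence-like schedule `N(n) → ∞`; `TendstoInDistribution.of_map_limit_eq` — the limit may
  be re-represented by any variable with the same law; `tendstoInMeasure_const_of_tendsto` — a
  convergent deterministic sequence converges in measure.
* **`TendstoInDistribution.mul_const_of_tendsto_gaussianReal`** (§1) — `X_n ⇒ N(0, v)` and
  `c_n → c` deterministic ⇒ `c_n X_n ⇒ N(0, c² v)` (Slutsky).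
* `invSqrt_total_mul_sum_sub_eq_sqrt_mul` (§2) — `(√N)⁻¹ Σ_r Σ_{t<N_r} (a − c) = √N (Σ_rΣ_t a/N − c)`.
* **`tendstoInDistribution_pooledSum_unequal_of_nHit`** (§3) — `κ` Markov, `π` invariant, Doeblin
  power, `|f| ≤ C`; `R = card ι ≥ 1` INDEPENDENT replicas from ANY laws `μ_r`, lengths `N_r(n)` with
  `N_r(n)/n → ρ_r > 0`: `(√N(n))⁻¹ Σ_r Σ_{t<N_r(n)} (f(x^r_t) − πf) ⇒ N(0, σ²_f)`.
* **`tendstoInDistribution_sqrt_total_mul_pooledMean_sub_of_nHit`** (§3) — the same as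
  `√N(n) (x̄_{N(n)} − πf) ⇒ N(0, σ²_f)`.

NOT CLAIMED: schedules with `N_r(n)/n → 0` for some `r` (a vanishing fraction — harmless in fact, not
typed); random lengths; dependent replicas; the pooled Γ-method error bar with unequal lengths (R3's
argument goes through verbatim; not filed here); anything numerical.
-/

namespace Summit.Ventures.LatticeQCDFlow.Exactness.GeneralNCMC

open MeasureTheory ProbabilityTheory Set Filter Finset
open scoped ENNReal NNReal Topology

/-! ## §1 Three generic facts about convergence in distribution -/

section Generic

variable {Ω₀ : Type*} [MeasurableSpace Ω₀] {P : Measure Ω₀} [IsProbabilityMeasure P]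
  {Ω' : Type*} [MeasurableSpace Ω'] {P' : Measure Ω'} [IsProbabilityMeasure P']
  {Ω'' : Type*} [MeasurableSpace Ω''] {P'' : Measure Ω''} [IsProbabilityMeasure P'']
  {E : Type*} [TopologicalSpace E] [MeasurableSpace E] [OpensMeasurableSpace E]

/-- Convergence in distribution along `atTop` is inherited by every schedule `N(n) → ∞`. -/
theorem TendstoInDistribution.comp_tendsto {X : ℕ → Ω₀ → E} {Z : Ω' → E}
    (h : TendstoInDistribution X atTop Z (fun _ => P) P') {N : ℕ → ℕ} (hN : Tendsto N atTop atTop) :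
    TendstoInDistribution (fun n => X (N n)) atTop Z (fun _ => P) P' where
  forall_aemeasurable n := h.forall_aemeasurable (N n)
  aemeasurable_limit := h.aemeasurable_limit
  tendsto := h.tendsto.comp hN

/-- The limit variable of a convergence in distribution may be replaced by any variable with the
same law. -/
theorem TendstoInDistribution.of_map_limit_eq {X : ℕ → Ω₀ → E} {Z : Ω' → E} {Z' : Ω'' → E}
    (h : TendstoInDistribution X atTop Z (fun _ => P) P') (hZ' : AEMeasurable Z' P'')
    (heq : P'.map Z = P''.map Z') :
    TendstoInDistribution X atTop Z' (fun _ => P) P'' where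
  forall_aemeasurable := h.forall_aemeasurable
  aemeasurable_limit := hZ'
  tendsto := by
    have ht := h.tendsto
    have hlim : (⟨P'.map Z, Measure.isProbabilityMeasure_map h.aemeasurable_limit⟩ :
        ProbabilityMeasure E) = ⟨P''.map Z', Measure.isProbabilityMeasure_map hZ'⟩ :=
      Subtype.ext heq
    rw [hlim] at ht
    exact ht

omit [IsProbabilityMeasure P] in
/-- A convergent DETERMINISTIC real sequence converges in measure (to its limit, as constants). -/
theorem tendstoInMeasure_const_of_tendsto {c : ℕ → ℝ} {c₀ : ℝ} (hc : Tendsto c atTop (𝓝 c₀)) :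
    TendstoInMeasure P (fun n (_ : Ω₀) => c n) atTop (fun _ => c₀) := by
  intro ε hε
  have hev : ∀ᶠ n in atTop, P {x : Ω₀ | ε ≤ edist (c n) c₀} = 0 := by
    have h1 : ∀ᶠ n in atTop, edist (c n) c₀ < ε := by
      have := (tendsto_order.1 (tendsto_iff_edist_tendsto_0.1 hc)).2 ε hε
      exact this
    filter_upwards [h1] with n hn
    have : {x : Ω₀ | ε ≤ edist (c n) c₀} = ∅ := by
      ext x
      simp only [mem_setOf_eq, mem_empty_iff_false, iff_false, not_le]
      exact hn
    rw [this, measure_empty]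
  exact tendsto_const_nhds.congr' (hev.mono fun n hn => hn.symm)

/-- **Slutsky for a deterministic scale**: `X_n ⇒ N(0, v)` (against `id`) and `c_n → c₀` ⇒
`c_n · X_n ⇒ N(0, c₀² v)` (against `id`). -/
theorem TendstoInDistribution.mul_const_of_tendsto_gaussianReal {X : ℕ → Ω₀ → ℝ} {v : ℝ≥0}
    (h : TendstoInDistribution X atTop id (fun _ => P) (gaussianReal 0 v))
    {c : ℕ → ℝ} {c₀ : ℝ} (hc : Tendsto c atTop (𝓝 c₀)) :
    TendstoInDistribution (fun n ω => c n * X n ω) atTop id (fun _ => P)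
      (gaussianReal 0 (NNReal.mk (c₀ ^ 2) (sq_nonneg _) * v)) := by
  -- Slutsky: `(X_n, c_n) ⇒ (Z, c₀)`, then the continuous map `(x, y) ↦ y x`
  have hs := h.continuous_comp_prodMk_of_tendstoInMeasure_const
    (g := fun p : ℝ × ℝ => p.2 * p.1) (by fun_prop)
    (Y := fun n (_ : Ω₀) => c n) (tendstoInMeasure_const_of_tendsto (P := P) hc)
    (fun n => measurable_const.aemeasurable)
  -- re-represent the limit `x ↦ c₀ x` under `N(0, v)` as `id` under `N(0, c₀² v)`
  refine TendstoInDistribution.of_map_limit_eq hs measurable_id.aemeasurable ?_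
  rw [Measure.map_id]
  change (gaussianReal 0 v).map (fun x : ℝ => c₀ * x) = _
  rw [gaussianReal_map_const_mul, mul_zero]

end Generic

/-! ## §2 The total-sample-size normalisation -/

section Algebra

variable {ι : Type*} [Fintype ι]

/-- `√(N_r/N) · (√N_r)⁻¹ S_r = (√N)⁻¹ S_r` whenever `S_r = 0` for `N_r = 0` (empty sums). -/
theorem sqrt_div_mul_invSqrt_mul (Nr N : ℕ) (S : ℝ) (hS : Nr = 0 → S = 0) :
    Real.sqrt ((Nr : ℝ) / N) * ((Real.sqrt Nr)⁻¹ * S) = (Real.sqrt N)⁻¹ * S := by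
  rcases Nat.eq_zero_or_pos Nr with h | h
  · simp [hS h]
  · have hr : (0 : ℝ) < Nr := by exact_mod_cast h
    rw [Real.sqrt_div' _ , ← mul_assoc, div_mul_eq_mul_div, mul_inv_cancel₀ (Real.sqrt_pos.2 hr).ne',
      one_div]
    exact Nat.cast_nonneg _

/-- `(√N)⁻¹ Σ_r Σ_{t<N_r} (a r t − c) = √N ((Σ_r Σ_{t<N_r} a r t)/N − c)` with `N = Σ_r N_r`. -/
theorem invSqrt_total_mul_sum_sub_eq_sqrt_mul (a : ι → ℕ → ℝ) (c : ℝ) (Nr : ι → ℕ) :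
    (Real.sqrt (∑ r, (Nr r : ℝ)))⁻¹ * ∑ r, ∑ t ∈ range (Nr r), (a r t - c)
      = Real.sqrt (∑ r, (Nr r : ℝ))
        * ((∑ r, ∑ t ∈ range (Nr r), a r t) / (∑ r, (Nr r : ℝ)) - c) := by
  set M : ℝ := ∑ r, (Nr r : ℝ) with hMdef
  have hsum : ∑ r, ∑ t ∈ range (Nr r), (a r t - c) = (∑ r, ∑ t ∈ range (Nr r), a r t) - M * c := by
    simp only [Finset.sum_sub_distrib, Finset.sum_const, Finset.card_range, nsmul_eq_mul, hMdef,
      Finset.sum_mul]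
  rw [hsum]
  rcases eq_or_lt_of_le (Finset.sum_nonneg (fun r (_ : r ∈ Finset.univ) =>
      (Nat.cast_nonneg (Nr r) : (0 : ℝ) ≤ (Nr r : ℝ)))) with hM | hM
  · have hM0 : M = 0 := by rw [hMdef]; exact hM.symm
    rw [hM0]
    simp
  · rw [← hMdef] at hM
    have hM0 : M ≠ 0 := hM.ne'
    calc (Real.sqrt M)⁻¹ * ((∑ r, ∑ t ∈ range (Nr r), a r t) - M * c)
        = (Real.sqrt M / M) * ((∑ r, ∑ t ∈ range (Nr r), a r t) - M * c) := by
          rw [Real.sqrt_div_self]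
      _ = Real.sqrt M * (((∑ r, ∑ t ∈ range (Nr r), a r t) - M * c) / M) := by ring
      _ = Real.sqrt M * ((∑ r, ∑ t ∈ range (Nr r), a r t) / M - c) := by
          rw [sub_div, mul_div_cancel_left₀ c hM0]

end Algebra

/-! ## §3 The pooled CLT with unequal replica lengths -/

section Pooled

variable {S : Type*} [MeasurableSpace S]
  {κ : Kernel S S} [IsMarkovKernel κ] {π : Measure S} [IsProbabilityMeasure π]
  {ν : Measure S} [IsProbabilityMeasure ν] {ε : ℝ≥0∞} {m : ℕ}
  {ι : Type*} [Fintype ι] [Nonempty ι]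

/-- **THE POOLED CLT WITH UNEQUAL REPLICA LENGTHS, FROM EVERY FAMILY OF INITIAL LAWS.**  `κ` Markov,
`π` invariant, `(nHit κ m)(z, ·) ≥ ε ν` (`ε ≠ 0`, `0 < m`), `|f| ≤ C` measurable; `R = card ι ≥ 1`
INDEPENDENT replicas, replica `r` started from `μ r` (ANY laws) and read for `N_r(n)` steps, where
`N_r(n)/n → ρ_r > 0`.  For every real random variable `Y` with law `N(0, σ²_f)`:
`(√N(n))⁻¹ Σ_r Σ_{t<N_r(n)} (f(x^r_t) − πf) ⇒ Y`, `N(n) = Σ_r N_r(n)`, under the replica law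
`⊗_r P_{μ r}`. -/
theorem tendstoInDistribution_pooledSum_unequal_of_nHit (hπ : Kernel.Invariant κ π) (hε : ε ≠ 0)
    (hmin : ∀ z, ε • ν ≤ nHit κ m z) (hm : 0 < m)
    {f : S → ℝ} (hf : Measurable f) {C : ℝ} (hC : ∀ x, |f x| ≤ C)
    (μ : ι → Measure S) [∀ r, IsProbabilityMeasure (μ r)]
    {Nr : ι → ℕ → ℕ} {ρ : ι → ℝ} (hρ : ∀ r, 0 < ρ r)
    (hN : ∀ r, Tendsto (fun n : ℕ => (Nr r n : ℝ) / n) atTop (𝓝 (ρ r)))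
    {Ω' : Type*} [MeasurableSpace Ω'] {P' : Measure Ω'} [IsProbabilityMeasure P'] {Y : Ω' → ℝ}
    (hY : HasLaw Y (gaussianReal 0 (Real.toNNReal (Scoring.autocov κ π (fun y => f y - ∫ z, f z ∂π) 0
        + 2 * ∑' t, Scoring.autocov κ π (fun y => f y - ∫ z, f z ∂π) (t + 1)))) P')
    [∀ r, IsProbabilityMeasure (Kernel.trajMeasure (X := fun _ : ℕ => S) (μ r)
        (fun n : ℕ => κ.comap (fun hh : (i : ↥(Finset.Iic n)) → S => hh ⟨n, Finset.mem_Iic.2 le_rfl⟩)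
          (measurable_pi_apply _)))] :
    TendstoInDistribution (fun (n : ℕ) (x : ι → ℕ → S) =>
        (Real.sqrt (∑ r, (Nr r n : ℝ)))⁻¹
          * ∑ r, ∑ t ∈ range (Nr r n), (f (x r t) - ∫ z, f z ∂π))
      atTop Y (fun _ => Measure.pi fun r => Kernel.trajMeasure (X := fun _ : ℕ => S) (μ r)
        (fun n : ℕ => κ.comap (fun hh : (i : ↥(Finset.Iic n)) → S => hh ⟨n, Finset.mem_Iic.2 le_rfl⟩)
          (measurable_pi_apply _))) P' := by
  set σ2 : ℝ≥0 := Real.toNNReal (Scoring.autocov κ π (fun y => f y - ∫ z, f z ∂π) 0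
        + 2 * ∑' t, Scoring.autocov κ π (fun y => f y - ∫ z, f z ∂π) (t + 1)) with hσ2
  set ρtot : ℝ := ∑ r, ρ r with hρtot
  have hρtot_pos : 0 < ρtot := Finset.sum_pos (fun r _ => hρ r) Finset.univ_nonempty
  -- each schedule tends to infinity, and the total grows like `ρtot · n`
  have hNr_top : ∀ r, Tendsto (Nr r) atTop atTop := by
    intro r
    have h1 : Tendsto (fun n : ℕ => ((Nr r n : ℝ) / n) * n) atTop atTop :=
      (hN r).pos_mul_atTop (hρ r) tendsto_natCast_atTop_atTop
    have h2 : Tendsto (fun n : ℕ => (Nr r n : ℝ)) atTop atTop := by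
      refine tendsto_atTop_mono' atTop ?_ h1
      filter_upwards [eventually_gt_atTop 0] with n hn
      have hn' : (0 : ℝ) < n := by exact_mod_cast hn
      rw [div_mul_cancel₀ _ hn'.ne']
    exact tendsto_natCast_atTop_iff.1 h2
  have hNtot : Tendsto (fun n : ℕ => (∑ r, (Nr r n : ℝ)) / n) atTop (𝓝 ρtot) := by
    have : (fun n : ℕ => (∑ r, (Nr r n : ℝ)) / n) = fun n => ∑ r, (Nr r n : ℝ) / n := by
      funext n; rw [Finset.sum_div]
    rw [this]
    exact tendsto_finsetSum _ fun r _ => hN r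
  -- the deterministic scale `√(N_r/N) → √(ρ_r/ρtot)`
  have hscale : ∀ r, Tendsto (fun n : ℕ => Real.sqrt ((Nr r n : ℝ) / ∑ r', (Nr r' n : ℝ))) atTop
      (𝓝 (Real.sqrt (ρ r / ρtot))) := by
    intro r
    refine (Real.continuous_sqrt.tendsto _).comp ?_
    have hq : Tendsto (fun n : ℕ => ((Nr r n : ℝ) / n) / ((∑ r', (Nr r' n : ℝ)) / n)) atTop
        (𝓝 (ρ r / ρtot)) := (hN r).div hNtot hρtot_pos.ne'
    refine hq.congr' ?_
    filter_upwards [eventually_gt_atTop 0] with n hn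
    have hn' : (0 : ℝ) < n := by exact_mod_cast hn
    rw [div_div_div_cancel_right₀ hn'.ne']
  -- per replica: the CLT along the schedule `N_r(n)`, then the deterministic scale (Slutsky)
  have hX : ∀ (r : ι) (n : ℕ), Measurable fun x : ℕ → S =>
      Real.sqrt ((Nr r n : ℝ) / ∑ r', (Nr r' n : ℝ))
        * ((Real.sqrt (Nr r n))⁻¹ * ∑ t ∈ range (Nr r n), (f (x t) - ∫ z, f z ∂π)) := fun r n =>
    measurable_const.mul (measurable_const.mul (Finset.measurable_sum _ fun t _ =>
      ((hf.comp (measurable_pi_apply t)).sub measurable_const)))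
  have h1 : ∀ r : ι, TendstoInDistribution (fun (n : ℕ) (x : ℕ → S) =>
        Real.sqrt ((Nr r n : ℝ) / ∑ r', (Nr r' n : ℝ))
          * ((Real.sqrt (Nr r n))⁻¹ * ∑ t ∈ range (Nr r n), (f (x t) - ∫ z, f z ∂π)))
      atTop id (fun _ => Kernel.trajMeasure (X := fun _ : ℕ => S) (μ r)
        (fun n : ℕ => κ.comap (fun hh : (i : ↥(Finset.Iic n)) → S => hh ⟨n, Finset.mem_Iic.2 le_rfl⟩)
          (measurable_pi_apply _)))
      (gaussianReal 0 (NNReal.mk (Real.sqrt (ρ r / ρtot) ^ 2) (sq_nonneg _) * σ2)) := by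
    intro r
    have h0 := tendstoInDistribution_timeAverage_of_nHit hπ hε hmin hm hf hC (μ r)
      (P' := gaussianReal 0 σ2) (Y := id) (by rw [hσ2, ← cltVariance_eq_autocov κ π f]; exact HasLaw.id)
    exact TendstoInDistribution.mul_const_of_tendsto_gaussianReal
      (TendstoInDistribution.comp_tendsto h0 (hNr_top r)) (hscale r)
  -- the variances add up to `σ2`
  have hvar : ∑ r, NNReal.mk (Real.sqrt (ρ r / ρtot) ^ 2) (sq_nonneg _) * σ2 = σ2 := by
    rw [← Finset.sum_mul]
    have : ∑ r, NNReal.mk (Real.sqrt (ρ r / ρtot) ^ 2) (sq_nonneg _) = 1 := by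
      apply NNReal.coe_injective
      push_cast
      have hsq : ∀ r, Real.sqrt (ρ r / ρtot) ^ 2 = ρ r / ρtot := fun r =>
        Real.sq_sqrt (div_nonneg (hρ r).le hρtot_pos.le)
      simp_rw [hsq, ← Finset.sum_div, ← hρtot]
      exact div_self hρtot_pos.ne'
    rw [this, one_mul]
  have hY' : HasLaw Y (gaussianReal 0 (∑ r, NNReal.mk (Real.sqrt (ρ r / ρtot) ^ 2) (sq_nonneg _) * σ2))
      P' := by rw [hvar]; exact hY
  have h2 := tendstoInDistribution_pi_sum
    (P := fun r => Kernel.trajMeasure (X := fun _ : ℕ => S) (μ r)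
      (fun n : ℕ => κ.comap (fun hh : (i : ↥(Finset.Iic n)) → S => hh ⟨n, Finset.mem_Iic.2 le_rfl⟩)
        (measurable_pi_apply _)))
    (X := fun (r : ι) (n : ℕ) (x : ℕ → S) =>
        Real.sqrt ((Nr r n : ℝ) / ∑ r', (Nr r' n : ℝ))
          * ((Real.sqrt (Nr r n))⁻¹ * ∑ t ∈ range (Nr r n), (f (x t) - ∫ z, f z ∂π)))
    hX h1 hY'
  refine h2.congr (fun n => Eventually.of_forall fun x => ?_) Filter.EventuallyEq.rfl
  -- `Σ_r √(N_r/N) (√N_r)⁻¹ S_r = (√N)⁻¹ Σ_r S_r`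
  show ∑ r, _ = (Real.sqrt (∑ r, (Nr r n : ℝ)))⁻¹
    * ∑ r, ∑ t ∈ range (Nr r n), (f (x r t) - ∫ z, f z ∂π)
  rw [Finset.mul_sum]
  refine Finset.sum_congr rfl fun r _ => ?_
  have hnat : (∑ r', (Nr r' n : ℝ)) = ((∑ r', Nr r' n : ℕ) : ℝ) := by push_cast; rfl
  rw [hnat, sqrt_div_mul_invSqrt_mul (Nr r n) (∑ r', Nr r' n) _ (fun h => by simp [h])]

/-- **THE POOLED MEAN AT THE TOTAL SAMPLE SIZE IS ASYMPTOTICALLY NORMAL**: with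
`x̄_{N(n)} = (Σ_r Σ_{t<N_r(n)} f(x^r_t))/N(n)`, `N(n) = Σ_r N_r(n)`, `N_r(n)/n → ρ_r > 0`:
`√N(n) (x̄_{N(n)} − πf) ⇒ N(0, σ²_f)` under the replica law, from EVERY family of initial laws — the
error bar of the pooled estimate is `√(σ²_f/N)` at the total length `N`, whatever the split. -/
theorem tendstoInDistribution_sqrt_total_mul_pooledMean_sub_of_nHit (hπ : Kernel.Invariant κ π)
    (hε : ε ≠ 0) (hmin : ∀ z, ε • ν ≤ nHit κ m z) (hm : 0 < m)
    {f : S → ℝ} (hf : Measurable f) {C : ℝ} (hC : ∀ x, |f x| ≤ C)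
    (μ : ι → Measure S) [∀ r, IsProbabilityMeasure (μ r)]
    {Nr : ι → ℕ → ℕ} {ρ : ι → ℝ} (hρ : ∀ r, 0 < ρ r)
    (hN : ∀ r, Tendsto (fun n : ℕ => (Nr r n : ℝ) / n) atTop (𝓝 (ρ r)))
    {Ω' : Type*} [MeasurableSpace Ω'] {P' : Measure Ω'} [IsProbabilityMeasure P'] {Y : Ω' → ℝ}
    (hY : HasLaw Y (gaussianReal 0 (Real.toNNReal (Scoring.autocov κ π (fun y => f y - ∫ z, f z ∂π) 0
        + 2 * ∑' t, Scoring.autocov κ π (fun y => f y - ∫ z, f z ∂π) (t + 1)))) P')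
    [∀ r, IsProbabilityMeasure (Kernel.trajMeasure (X := fun _ : ℕ => S) (μ r)
        (fun n : ℕ => κ.comap (fun hh : (i : ↥(Finset.Iic n)) → S => hh ⟨n, Finset.mem_Iic.2 le_rfl⟩)
          (measurable_pi_apply _)))] :
    TendstoInDistribution (fun (n : ℕ) (x : ι → ℕ → S) =>
        Real.sqrt (∑ r, (Nr r n : ℝ))
          * ((∑ r, ∑ t ∈ range (Nr r n), f (x r t)) / (∑ r, (Nr r n : ℝ)) - ∫ z, f z ∂π))
      atTop Y (fun _ => Measure.pi fun r => Kernel.trajMeasure (X := fun _ : ℕ => S) (μ r)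
        (fun n : ℕ => κ.comap (fun hh : (i : ↥(Finset.Iic n)) → S => hh ⟨n, Finset.mem_Iic.2 le_rfl⟩)
          (measurable_pi_apply _))) P' := by
  have h := tendstoInDistribution_pooledSum_unequal_of_nHit hπ hε hmin hm hf hC μ hρ hN hY
  refine h.congr (fun n => Eventually.of_forall fun x => ?_) Filter.EventuallyEq.rfl
  exact invSqrt_total_mul_sum_sub_eq_sqrt_mul (fun r t => f (x r t)) (∫ z, f z ∂π) (fun r => Nr r n)

end Pooled

end Summit.Ventures.LatticeQCDFlow.Exactness.GeneralNCMC
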